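import Summits.FinalStateConjecture.FinalStateConjecture.Theorems.BartnikGapSettlingGapExhaustionIKStepNormalisedData
import HarnessLib

/-!
# Crux `GapExhaustion` (stmt-FinalStateConjecture-10808), line `photon-shell-pseudoconvexity`:
# stub `stub_ikQuant6Out` — the NORMALISED DATA at a cylinder point on the OUTER side
# (inward sweep S3) and Ionescu–Klainerman's hypotheses (smoothness constant, non-degeneracy,
# quantitative pseudo-convexity)

Route `BartnikGapSettling`; helper (`--supports stmt-FinalStateConjecture-10808`) of line lead
c10, companion of `…IKStepNormalisedData` (p135270). The inward sweep S3 extends the scri-side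
Killing field across the cylinders `{r = c}` from the data on `{r > c}`; at a cylinder point `x`
the chart is normalised exactly as for the outward sweep (affine change `y ↦ x + Ls y`,
`Ls = s L`, `G x (L·, L·) = η`, components rescaled by `s⁻²`,
`Gt y = s⁻² G(x + Ls y) ∘ (Ls × Ls)`), but IK's local extension theorem is fed the defining
function `ft y = s⁻² (c − r(x + Ls y))`, so that `{ft < 0} = {r > c}`. Since `ft = −ft_in`
(`ikStepOut_ft_eq_neg`), everything is read off the inner-side file: `ft 0 = 0`,
`D ft(0) = −s⁻¹ Dr(x) ∘ L` (`ikStepOut_ft_basic`); IK's smoothness sum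
`Σ_{j=1}^6 ‖Dʲ Gt‖ + Σ_{j=1}^4 ‖Dʲ ft‖ ≤ 6·6⁸(C_K + 1) + 4·6⁴ C_K / s` is literally the inner one
(`ikStepOut_bound_A`, `‖Dʲ(−f)‖ = ‖Dʲ f‖`); and the registered stub `stub_ikQuant6Out` —
`‖D ft(0)‖ ≥ A₁⁻¹` and (quant6) at the origin with constant `A₁` — follows from the OUTER
multiplier form of Ionescu–Klainerman JAMS 2013 Lemma 2.11 (a) at `x` (`+ Hess r`, beyond the
photon shell) transported by `affineCov_hessAt` (p133643) with the constant `α = −s⁻²`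
(`ikStep_hessAt_const_mul_sub`).
-/

noncomputable section

set_option maxSynthPendingDepth 3

-- D-0017: single-problem summit, `Summit.<S>.<S>.…` by design (cf. lakefile `weak.linter.dupNamespace`).
set_option linter.dupNamespace false

namespace Summit.FinalStateConjecture.FinalStateConjecture.Theorems

open Set Function Metric
open Literature.Geometry.Lorentzian Literature.Geometry.Lorentzian.MetricCoord
open scoped Manifold ContDiff Topology ENNReal

/-! ### The normalised data at a cylinder point, outer side -/

section NormalisedDataOut

variable {G : E4 → E4 →L[ℝ] E4 →L[ℝ] ℝ} {W : Set E4} {a c s : ℝ} {x : E4} {L Ls : E4 ≃L[ℝ] E4}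
  {Gt : E4 → E4 →L[ℝ] E4 →L[ℝ] ℝ} {ft : E4 → ℝ}

/-- The outer-side defining function is the negative of the inner-side one:
`s⁻² (c − r ∘ aff) = −(s⁻² (r ∘ aff − c))`. [folklore] -/
theorem ikStepOut_ft_eq_neg {fti : E4 → ℝ}
    (hft : ∀ y : E4, ft y = (s ^ 2)⁻¹ * (c - Kerr.radius a (x + Ls y)))
    (hfti : fti = fun y : E4 => (s ^ 2)⁻¹ * (Kerr.radius a (x + Ls y) - c)) :
    ft = -fti := by
  funext y
  simp only [Pi.neg_apply, hft, hfti]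
  ring

/-- `ft` is smooth near points where `r` is, vanishes at the origin when `r x = c`, and
`D ft(0) X = −s⁻¹ Dr(x)(L X)` (outer side: `ft = s⁻² (c − r ∘ aff)`). [folklore] -/
theorem ikStepOut_ft_basic (hs : 0 < s) (hLs : ∀ v : E4, Ls v = s • L v) (hx : Kerr.radius a x = c)
    (hft : ∀ y : E4, ft y = (s ^ 2)⁻¹ * (c - Kerr.radius a (x + Ls y)))
    (hr0 : ContDiffAt ℝ ∞ (Kerr.radius a) x) :
    ft 0 = 0 ∧
    (∀ X : E4, fderiv ℝ ft 0 X = -(s⁻¹ * fderiv ℝ (Kerr.radius a) x (L X))) ∧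
    fderiv ℝ ft 0 = -(s⁻¹ • (fderiv ℝ (Kerr.radius a) x).comp (L : E4 →L[ℝ] E4)) ∧
    (∀ y : E4, ContDiffAt ℝ ∞ (Kerr.radius a) (x + Ls y) → ContDiffAt ℝ ∞ ft y) := by
  obtain ⟨fti, hfti⟩ :
      ∃ fti : E4 → ℝ, fti = fun y : E4 => (s ^ 2)⁻¹ * (Kerr.radius a (x + Ls y) - c) := ⟨_, rfl⟩
  obtain ⟨_, hfd, hfd', hsm⟩ := ikStep_ft_basic (ft := fti) hs hLs hx (fun y => by rw [hfti]) hr0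
  have hneg : ft = -fti := ikStepOut_ft_eq_neg hft hfti
  refine ⟨by simp [hft, hx], fun X => ?_, ?_, fun y hy => ?_⟩
  · rw [hneg, fderiv_neg, neg_apply, hfd]
  · rw [hneg, fderiv_neg, hfd']
  · rw [hneg]
    exact (hsm y hy).neg

/-- **IK's smoothness constant, outer side.** At a point `y` whose image `x + Ls y` lies in `W`
with `r > 0`, the derivative sums of the normalised data `(Gt, ft)`, `ft = s⁻² (c − r ∘ aff)`, are
bounded by `6·6⁸(C_K + 1) + 4·6⁴ C_K / s`, from the band bounds `‖Dʲ r‖ ≤ C_K`,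
`‖Dʲ G‖ ≤ C_K + 1` (`j ≤ 6`): the inner-side bound verbatim, as `‖Dʲ(−f)‖ = ‖Dʲ f‖`. [folklore] -/
theorem ikStepOut_bound_A (hGmet : IsMetricOn G W) (hs : 0 < s) (hs1 : s ≤ 1)
    (hLs : (Ls : E4 →L[ℝ] E4) = s • (L : E4 →L[ℝ] E4)) (hL6 : ‖(L : E4 →L[ℝ] E4)‖ ≤ 6)
    (hGt : ∀ y : E4, Gt y =
      (s ^ 2)⁻¹ • (G (x + Ls y)).bilinearComp (Ls : E4 →L[ℝ] E4) (Ls : E4 →L[ℝ] E4))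
    (hft : ∀ y : E4, ft y = (s ^ 2)⁻¹ * (c - Kerr.radius a (x + Ls y)))
    {CK : ℝ} (hCK : 0 ≤ CK) {y : E4} (hyW : x + Ls y ∈ W) (hr0 : 0 < Kerr.radius a (x + Ls y))
    (hKr : ∀ j : ℕ, j ≤ 6 → ‖iteratedFDeriv ℝ j (Kerr.radius a) (x + Ls y)‖ ≤ CK)
    (hKG : ∀ j : ℕ, j ≤ 6 → ‖iteratedFDeriv ℝ j G (x + Ls y)‖ ≤ CK + 1) :
    (∑ j ∈ Finset.Icc 1 6, ‖iteratedFDeriv ℝ j Gt y‖) +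
        (∑ j ∈ Finset.Icc 1 4, ‖iteratedFDeriv ℝ j ft y‖) ≤
      6 * (6 ^ 8 * (CK + 1)) + 4 * (6 ^ 4 * CK) / s := by
  obtain ⟨fti, hfti⟩ :
      ∃ fti : E4 → ℝ, fti = fun y : E4 => (s ^ 2)⁻¹ * (Kerr.radius a (x + Ls y) - c) := ⟨_, rfl⟩
  have hb := ikStep_bound_A (ft := fti) hGmet hs hs1 hLs hL6 hGt (fun y => by rw [hfti]) hCK hyW hr0
    hKr hKG
  have hneg : ft = -fti := ikStepOut_ft_eq_neg hft hfti
  have hnj : ∀ j : ℕ, ‖iteratedFDeriv ℝ j ft y‖ = ‖iteratedFDeriv ℝ j fti y‖ := fun j => by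
    rw [hneg, iteratedFDeriv_neg_apply, norm_neg]
  simp only [hnj]
  exact hb

end NormalisedDataOut

/-- **IK's quantitative pseudo-convexity (quant6) and non-degeneracy at the centre, outer side**
(registered stub of line lead c10 for the inward sweep S3), from the multiplier form of
Ionescu–Klainerman JAMS 2013 Lemma 2.11 (a) for `h = r` at `x` beyond the photon shell
(`stub_kerrMultiplierBeyondShell`, `+ Hess r`) transported to the normalised data
`(Gt, ft = s⁻² (c − r ∘ aff))` by the tensoriality of the coordinate Hessian under the affine
change (`Hess_{Gt} ft (0)(X, X) = −Hess_G r (x)(LX, LX)`) and its invariance under constant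
rescaling. [cite: IonescuKlainerman2013, Lemma 2.11] -/
theorem stub_ikQuant6Out :
    ∀ (G : E4 → E4 →L[ℝ] E4 →L[ℝ] ℝ) (W : Set E4) (a c s : ℝ) (x : E4) (L Ls : E4 ≃L[ℝ] E4)
      (Gt : E4 → E4 →L[ℝ] E4 →L[ℝ] ℝ) (ft : E4 → ℝ) (ν ε₁ μ₀ A₁ : ℝ),
      IsMetricOn G W → (∀ z ∈ W, ricAt G z = 0) → x ∈ W → 0 < s → s ≤ 1 →
      (∀ v : E4, Ls v = s • L v) → (∀ v w : E4, G x (L v) (L w) = Minkowski.bilin v w) →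
      ‖(L.symm : E4 →L[ℝ] E4)‖ ≤ 6 →
      (∀ y : E4, Gt y =
        (s ^ 2)⁻¹ • (G (x + Ls y)).bilinearComp (Ls : E4 →L[ℝ] E4) (Ls : E4 →L[ℝ] E4)) →
      Kerr.radius a x = c →
      (∀ y : E4, ft y = (s ^ 2)⁻¹ * (c - Kerr.radius a (x + Ls y))) →
      ContDiffAt ℝ ∞ (Kerr.radius a) x → 0 < ν → 0 < ε₁ → 0 < A₁ →
      ν ≤ ‖fderiv ℝ (Kerr.radius a) x‖ → |μ₀| ≤ ε₁⁻¹ →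
      (∀ w : E4, ε₁ ^ 2 * ‖w‖ ^ 2 ≤ μ₀ * G x w w + hessAt G (Kerr.radius a) x w w
        + ε₁⁻¹ ^ 2 * (fderiv ℝ (Kerr.radius a) x w) ^ 2) →
      36 * ε₁⁻¹ ^ 2 ≤ A₁ → ε₁⁻¹ ≤ A₁ → 6 / ν ≤ A₁ →
      A₁⁻¹ ≤ ‖fderiv ℝ ft 0‖ ∧
      ∃ μ ∈ Icc (-A₁) A₁, ∀ X : E4,
        A₁⁻¹ * ‖X‖ ^ 2 ≤ μ * Gt 0 X X - hessAt Gt ft 0 X X + A₁ * (fderiv ℝ ft 0 X) ^ 2 := by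
  intro G W a c s x L Ls Gt ft ν ε₁ μ₀ A₁ hGmet hric hxW hs hs1 hLs hL hLs6 hGt hx hft hr0 hν hε₁ hA₁pos
    hνx hμ₀ hUout hA₁ε2 hA₁ε hA₁ν
  obtain ⟨_, hfd, hfd', _⟩ := ikStepOut_ft_basic hs hLs hx hft hr0
  obtain ⟨_, _, _, hGthess, hGtap⟩ := ikStep_Gt_basic hGmet hric hs hLs hL hGt
  have haff0 : x + Ls 0 = x := by simp
  have h0W : (0 : E4) ∈ (fun y : E4 => x + Ls y) ⁻¹' W := by
    show x + Ls 0 ∈ W; rwa [haff0]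
  -- the non-degeneracy of `D ft(0)`
  have hnorm : A₁⁻¹ ≤ ‖fderiv ℝ ft 0‖ := by
    have hcomp : ‖fderiv ℝ (Kerr.radius a) x‖ ≤
        ‖(fderiv ℝ (Kerr.radius a) x).comp (L : E4 →L[ℝ] E4)‖ * 6 :=
      (ikStep_norm_le_norm_comp_mul _ L).trans (mul_le_mul_of_nonneg_left hLs6 (norm_nonneg _))
    rw [hfd', norm_neg, norm_smul, Real.norm_eq_abs, abs_of_pos (inv_pos.2 hs)]
    have h1 : A₁⁻¹ ≤ ν / 6 := by
      rw [inv_le_comm₀ hA₁pos (by positivity), inv_div]; exact hA₁ν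
    have h2 : ν / 6 ≤ ‖(fderiv ℝ (Kerr.radius a) x).comp (L : E4 →L[ℝ] E4)‖ := by
      rw [div_le_iff₀ (by norm_num)]; exact hνx.trans hcomp
    have h3 : ‖(fderiv ℝ (Kerr.radius a) x).comp (L : E4 →L[ℝ] E4)‖ ≤
        s⁻¹ * ‖(fderiv ℝ (Kerr.radius a) x).comp (L : E4 →L[ℝ] E4)‖ := by
      have h1s : 1 ≤ s⁻¹ := (one_le_inv₀ hs).2 hs1
      have hn := norm_nonneg ((fderiv ℝ (Kerr.radius a) x).comp (L : E4 →L[ℝ] E4))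
      calc ‖(fderiv ℝ (Kerr.radius a) x).comp (L : E4 →L[ℝ] E4)‖
          = 1 * ‖(fderiv ℝ (Kerr.radius a) x).comp (L : E4 →L[ℝ] E4)‖ := (one_mul _).symm
        _ ≤ s⁻¹ * ‖(fderiv ℝ (Kerr.radius a) x).comp (L : E4 →L[ℝ] E4)‖ :=
          mul_le_mul_of_nonneg_right h1s hn
    exact h1.trans (h2.trans h3)
  refine ⟨hnorm, μ₀, ⟨by linarith [(abs_le.1 hμ₀).1], (abs_le.1 hμ₀).2.trans hA₁ε⟩, fun X ↦ ?_⟩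
  -- the defining function as `α (r ∘ aff − c)` with `α = −s⁻²`
  have hft'' : ft = fun y : E4 => -(s ^ 2)⁻¹ * (Kerr.radius a (x + Ls y) - c) := by
    funext y; rw [hft]; ring
  -- the Hessian of `ft` for `Gt` at `0`, read through `G` at `x`
  have hhess : hessAt Gt ft 0 X X = -hessAt G (Kerr.radius a) x (L X) (L X) := by
    rw [hGthess 0 h0W ft, ← affineCov_eq_pullMetric G Ls x, hft'']
    have hg2 : ContDiffAt ℝ 2 (fun y : E4 => Kerr.radius a (x + Ls y)) 0 := by
      have haff : ContDiff ℝ 2 (fun y : E4 => x + Ls y) :=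
        contDiff_const.add (Ls : E4 →L[ℝ] E4).contDiff
      have hr2 : ContDiffAt ℝ 2 (Kerr.radius a) (x + Ls 0) := by
        rw [haff0]; exact hr0.of_le (WithTop.coe_le_coe.mpr le_top)
      have g1 := ContDiffAt.comp (g := Kerr.radius a) (f := fun y : E4 => x + Ls y) (0 : E4) hr2
        haff.contDiffAt
      simpa only [Function.comp_def] using g1
    rw [ikStep_hessAt_const_mul_sub _ hg2, smul_apply, smul_apply, smul_eq_mul,
      affineCov_hessAt G (Kerr.radius a) Ls x 0 W hGmet (by rwa [haff0])
        (by rw [haff0]; exact hr0.of_le (WithTop.coe_le_coe.mpr le_top)),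
      haff0, hLs]
    simp only [map_smul, smul_apply, smul_eq_mul]
    field_simp
  have hG0 : Gt 0 X X = G x (L X) (L X) := by
    rw [hGtap, haff0, hLs]
    simp only [map_smul, smul_apply, smul_eq_mul]
    field_simp
  have hD : fderiv ℝ ft 0 X = -(s⁻¹ * fderiv ℝ (Kerr.radius a) x (L X)) := hfd X
  rw [hhess, hG0, hD, neg_sq, sub_neg_eq_add]
  -- the inequality
  have hw := hUout (L X)
  have hXn : ‖X‖ ≤ 6 * ‖L X‖ :=
    (ikStep_norm_le_mul_norm_apply L X).trans (mul_le_mul_of_nonneg_right hLs6 (norm_nonneg _))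
  have hXn2 : ‖X‖ ^ 2 ≤ 36 * ‖L X‖ ^ 2 := by
    have h := mul_self_le_mul_self (norm_nonneg X) hXn
    nlinarith only [h]
  have hA₁inv : A₁⁻¹ * 36 ≤ ε₁ ^ 2 := by
    rw [inv_mul_le_iff₀ hA₁pos]
    have h1 : 36 * ε₁⁻¹ ^ 2 * ε₁ ^ 2 = 36 := by field_simp
    have h2 : 36 * ε₁⁻¹ ^ 2 * ε₁ ^ 2 ≤ A₁ * ε₁ ^ 2 :=
      mul_le_mul_of_nonneg_right hA₁ε2 (sq_nonneg _)
    linarith only [h1, h2]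
  have hlhs : A₁⁻¹ * ‖X‖ ^ 2 ≤ ε₁ ^ 2 * ‖L X‖ ^ 2 := by
    calc A₁⁻¹ * ‖X‖ ^ 2 ≤ A₁⁻¹ * (36 * ‖L X‖ ^ 2) := by gcongr
      _ = (A₁⁻¹ * 36) * ‖L X‖ ^ 2 := by ring
      _ ≤ ε₁ ^ 2 * ‖L X‖ ^ 2 := by gcongr
  have hcoef : ε₁⁻¹ ^ 2 ≤ A₁ * s⁻¹ ^ 2 := by
    have h0 : 0 ≤ ε₁⁻¹ ^ 2 := sq_nonneg _
    have h1 : ε₁⁻¹ ^ 2 ≤ A₁ := by linarith only [hA₁ε2, h0]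
    have h2 : 1 ≤ s⁻¹ ^ 2 := one_le_pow₀ ((one_le_inv₀ hs).2 hs1)
    calc ε₁⁻¹ ^ 2 ≤ A₁ := h1
      _ = A₁ * 1 := (mul_one _).symm
      _ ≤ A₁ * s⁻¹ ^ 2 := mul_le_mul_of_nonneg_left h2 hA₁pos.le
  have hrhs : ε₁⁻¹ ^ 2 * (fderiv ℝ (Kerr.radius a) x (L X)) ^ 2 ≤
      A₁ * (s⁻¹ * fderiv ℝ (Kerr.radius a) x (L X)) ^ 2 := by
    rw [mul_pow, ← mul_assoc]
    exact mul_le_mul_of_nonneg_right hcoef (sq_nonneg _)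
  linarith only [hw, hlhs, hrhs]

end Summit.FinalStateConjecture.FinalStateConjecture.Theorems

end
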